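/-
Copyright (c) 2026 the pub-hodgecm-mathlib formalisation cell (harness21).  Prover seat hodgecm-mathlib-K2E5-p17 (g7), Track B «K2-LIT» ∕ h413
(`stmt-HodgeConjecture-24833`), line `K2_E3_EllipticInputs`, leaf (nsc-S-A′), brick GEO-QB (dealer D92; architect K2E3-p25 (g2) MEMO-SA-architecture v2 §3;
hand-off plan K2E3-p21 (g6) `MEMO-GEOQB-handoff.v1`), part (G3a).  2026-09-04.
-/
import Summits.HodgeConjecture.HodgeConjecture.Theorems.K2E3ParabolicCellJacquetLine        -- ★ GEO-QB (G2) (K2E3-p21): one `(P_c,B)`-cell = a line with character; (G1); `mul_blockDiagonalGL_mem_cellsBelow`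
import Summits.HodgeConjecture.HodgeConjecture.Theorems.K2E3GL3BruhatCellFunctionals        -- ★ E3β₃a (K2E3-p25): `inducingChar_apply(_of_mem_upperUnitriangular)`, `conj_mem_unipotentRadicalGL_of_mem_parabolic`; brings ★ E3β₁∕E3β₂
import Summits.HodgeConjecture.HodgeConjecture.Theorems.K2E3GL3StandardModuleEmbedding       -- ★ STD-EMB (K2E3-p03): `inducing_scalar_borel_eq`, `isOpen_ker_psiQ`; brings `monotone_twoOne`
import Literature.NumberTheory.Automorphic.UnipotentRadicalCompactOpenProofs                  -- ★ `IsLimitOfCompactOpen.of_le`, `isClosed_unipotentRadicalGL`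
import Literature.NumberTheory.Automorphic.GLnLeviOrbitalDescent                              -- ★ `isClosed_standardLeviGL`
import Literature.NumberTheory.Automorphic.SmoothCharacterOfCharacter                         -- ★ `isSmooth_trivial_twist`
import HarnessLib

/-!
# K2_E3 road (h413), leaf (nsc-S-A′), brick GEO-QB (G3a) — the three `(Q, B)`-cells of the standard module `D(η,ψ) = Ind_Q^{GL₃}((η∘det₂ ⊠ ψ)δ_Q^{1∕2})`:
# cell data for `Q = P₂₁`, the inducing character of `D` on `B`, and the line of the closed cell `1`

Cell `pub/hodgecm-mathlib` (D-0151), Track B, seat K2E5-p17 (g7); plan K2E3-p21 (g6) `K2/K2E3-p21/g6/MEMO-GEOQB-handoff.v1.K2E3-p21-g6.md` (head «=» architect K2E3-p25 (g2),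
bus 11:28:14Z).  `--supports stmt-HodgeConjecture-24833 --as helper`; THEOREMS ONLY (no definition ∕ instance ∕ notation ∕ `sorry`); never imports `Cruxes/…/Lines`; COUNT-NEUTRAL.

CURRENCY (architect MEMO-SA-architecture v2 §0, ★ STD-EMB, spelled inline): `Q := standardParabolicGL F ![false,false,true]` (`P₂₁`), Levi `M_Q := Π a : Bool, GL {i // ![f,f,t] i = a} F`,
`ψ_Q := (η ∘ det ∘ ev_false) · (ψ ∘ det ∘ ev_true)`, inducing datum `σ′_Q := ((𝟙.twist ψ_Q) ∘ proj_Q) ⊗ δ_Q^{1∕2}`, `D := smoothIndRep Q σ′_Q` (`= parabolicIndGL F ![f,f,t] (𝟙.twist ψ_Q)`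
by `rfl`), `ν½ := (unramifiedTwist F (1/2)).toMonoidHom`, `θ_D := ![η ν½⁻¹, η ν½, ψ]`, `tch θ := ∏ a, (θ a) ∘ det ∘ ev_a` (character of the diagonal torus `T`), `U = U₃`, `B = P_{id}`,
root groups `U_Q = unipotentRadicalGL F ![f,f,t]` (roots (0,2),(1,2)), `U_{Q′} = unipotentRadicalGL F ![f,t,t]` (roots (0,1),(0,2)), `U_{α₂} = U_Q ⊓ M_{Q′}` (root (1,2)),
`U_Q⁻ = unipotentRadicalGL F (toDual ∘ ![f,f,t])` (roots (2,0),(2,1)) — the radical opposite to `Q`.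

THE MATHEMATICS ([BernsteinZelevinsky1977, Thm. 5.2 — the geometric lemma for the pair `(Q, B)` of `GL₃`]; [Casselman1995, §6.3]; [Zelevinsky1980, §1.2, §1.6]).  `Q\GL₃/B` has
three cells `Q P_w B`, `w ∈ {1, s₂ = (1 2), s₁s₂}` (the shuffles of the `GL₂`-letters with the `GL₁`-letter), of keys `key 1 < key s₂ < key s₁s₂` (★ `cellKey ![f,f,t]`).  For each, the
cell datum `(S_w, Γ_w, proj_w)` of ★ GEO-QB (G1)∕(G2) is the Borel one of ★ E3β₁∕E3β₂ (`1 ↦ (U, 1)`, `s₂ ↦ (U_{Q′}, U_{α₂})`, `s₁s₂ ↦ (U_{α₂}, U_{Q′})`), now with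
`S_w = {u ∈ U : P_w u P_w⁻¹ ∈ Q}` and `P_w Γ_w P_w⁻¹ ⊆ U_Q⁻` (§3).  The scalar bridge (§2, ★ STD-EMB `inducing_scalar_borel_eq`): ON `B ≤ Q` the inducing character of `D` IS the
inducing character `δ_B^{1∕2} · tch θ_D` of the principal series `I(θ_D)`; hence the `U`-invariance (`hinv`) and torus-equivariance (`hT`) computations of ★ E3β₃a∕c transfer
verbatim with `χ := tch θ_D`, and each cell contributes EXACTLY A LINE to `r_U(D)` on which the normalised torus acts by `tch θ_D ∘ Ad(P_w) = tch (θ_D ∘ w⁻¹)` (§4: the cell `1`, stated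
for ANY smooth `σ′` on `ℂ` agreeing with `δ_B^{1∕2}·(χ ∘ proj_B)` on `B`; the cells `s₂`, `s₁s₂` are (G3b) `K2E3GL3StandardModuleJacquetLines`, the assembly and the exponent table of
`D(η,ψ)` are (G3c) `K2E3GL3StandardModuleJacquetDimension`).
HONEST LABEL: HC_CM is proved only modulo the 7 printed citations (2 remaining named inputs: hLiu418 = stmt-HodgeConjecture-24832, h413 = stmt-HodgeConjecture-24833) until rung 0
closes; count-neutral helper (representation theory of `GL₃(F)`; no printed citation is discharged).

## Mathlib ∕ tree search
Tree ★: (G2) `K2E3ParabolicCellJacquetLine.exists_lineFunctional_of_cellDatum` · (G1) · E3β₁ `cellDatum_one`∕`cellDatum_swap_one_two`∕`mem_*_three_iff`∕`permGL_conj_apply` · E3β₂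
`exists_proj_swap_one_two`∕`exists_homeomorph_rootGroup_oneTwo`∕`measure_map_addHomeomorph`∕`blockDiagonalGL_inv_mul_coord_mul`∕`blockDiagonalGL_id_three_apply_ne_zero` · E3β₃a
`inducingChar_apply`∕`inducingChar_apply_of_mem_upperUnitriangular`∕`conj_mem_unipotentRadicalGL_of_mem_parabolic`∕`upperUnitriangular_le_parabolic_two_block` · STD-EMB
`inducing_scalar_borel_eq`∕`isOpen_ker_psiQ` · `rootDeltaChar_borel_three` · Mathlib `map_mul_left_addHaar`-type lemma ★ E3β₂, `MeasureTheory.integral_mul_right_eq_self`.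
Dedup: `rg "StandardModuleJacquetCells|inducingCharQ|cellDatumQ"` over `Theorems/` — none.

## References
* [BernsteinZelevinsky1977] I. N. Bernstein, A. V. Zelevinsky, *Induced representations of reductive p-adic groups I*, Ann. Sci. ÉNS 10 (1977), 1.7–1.9, §2.3, Thm. 5.2.
* [Casselman1995] W. Casselman, *Introduction to the theory of admissible representations of p-adic reductive groups* (draft 1995), §1.5, §6.3 (Prop. 6.3.3, Thm. 6.3.5).
* [Zelevinsky1980] A. V. Zelevinsky, *Induced representations of reductive p-adic groups II*, Ann. Sci. ÉNS 13 (1980), §1.2, §1.6.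
-/

set_option autoImplicit false
-- the mandated namespace repeats `HodgeConjecture.HodgeConjecture`, as in every `Theorems/*.lean` of this sub-problem
set_option linter.dupNamespace false

noncomputable section

open Set Function MeasureTheory Measure Filter Representation
open scoped MatrixGroups NNReal ENNReal

namespace Summit.HodgeConjecture.HodgeConjecture.Cruxes.H413.K2E3GL3StandardModuleJacquetCells

open Literature.NumberTheory.Automorphic ValuativeRel
open Literature.NumberTheory.GaloisRepresentations Literature.NumberTheory.GaloisRepresentations.IsNonarchimedeanLocalField
open Summit.HodgeConjecture.HodgeConjecture.Cruxes.H413.K2E3GL3BorelUnipotentHaar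
open Summit.HodgeConjecture.HodgeConjecture.Cruxes.H413.K2E3GL3BruhatCellSubgroups
open Summit.HodgeConjecture.HodgeConjecture.Cruxes.H413.K2E3GL3BruhatCellHaar
open Summit.HodgeConjecture.HodgeConjecture.Cruxes.H413.K2E3BorelCellJacquetLine (permGL_conj_blockDiagonalGL_mem_borel)
open Summit.HodgeConjecture.HodgeConjecture.Cruxes.H413.K2E3BorelCellCoinvariantsBound (permGL_conj_mem_upperUnitriangular)
open Summit.HodgeConjecture.HodgeConjecture.Cruxes.H413.K2E3GL3BruhatCellFunctionals
open Summit.HodgeConjecture.HodgeConjecture.Cruxes.H413.K2E3GL3InductionInStagesEmbedding (monotone_twoOne)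
open Summit.HodgeConjecture.HodgeConjecture.Cruxes.H413.K2E3GL3StandardModuleEmbedding (inducing_scalar_borel_eq isOpen_ker_psiQ)

variable {F : Type} [Field F]

/-! ## §1 Entrywise membership in `Q = P₂₁` and in the opposite radical `U_Q⁻` -/

/-- `g ∈ Q = P₂₁ ↔ g₂₀ = g₂₁ = 0`. [cite: BernsteinZelevinsky1977, §2.1] -/
theorem mem_parabolic_twoOne_iff (g : GL (Fin 3) F) :
    g ∈ standardParabolicGL F (![false, false, true] : Fin 3 → Bool) ↔ (g : Matrix (Fin 3) (Fin 3) F) 2 0 = 0 ∧ (g : Matrix (Fin 3) (Fin 3) F) 2 1 = 0 := by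
  rw [mem_standardParabolicGL_iff]
  constructor
  · intro h
    exact ⟨h (show (![false, false, true] : Fin 3 → Bool) 0 < (![false, false, true] : Fin 3 → Bool) 2 by decide), h (show (![false, false, true] : Fin 3 → Bool) 1 < (![false, false, true] : Fin 3 → Bool) 2 by decide)⟩
  · rintro ⟨h20, h21⟩ i j hij
    fin_cases i <;> fin_cases j <;> first | exact absurd hij (by decide) | exact h20 | exact h21

/-- `g ∈ U_Q⁻ = unipotentRadicalGL F (toDual ∘ ![f,f,t])` (block LOWER unitriangular for the blocks `{0,1} ∣ {2}`) iff `g₀₁ = g₀₂ = g₁₀ = g₁₂ = 0` and `g₀₀ = g₁₁ = g₂₂ = 1`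
(the entries `g₂₀, g₂₁` are free). [cite: BernsteinZelevinsky1977, §2.1] -/
theorem mem_oppositeRadical_twoOne_iff (g : GL (Fin 3) F) :
    g ∈ (unipotentRadicalGL F (⇑OrderDual.toDual ∘ (![false, false, true] : Fin 3 → Bool))) ↔
      (g : Matrix (Fin 3) (Fin 3) F) 0 1 = 0 ∧ (g : Matrix (Fin 3) (Fin 3) F) 0 2 = 0 ∧ (g : Matrix (Fin 3) (Fin 3) F) 1 0 = 0 ∧ (g : Matrix (Fin 3) (Fin 3) F) 1 2 = 0 ∧
      (g : Matrix (Fin 3) (Fin 3) F) 0 0 = 1 ∧ (g : Matrix (Fin 3) (Fin 3) F) 1 1 = 1 ∧ (g : Matrix (Fin 3) (Fin 3) F) 2 2 = 1 := by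
  rw [mem_unipotentRadicalGL_iff_apply]
  constructor
  · intro h
    exact ⟨by simpa using h 0 1 (by decide), by simpa using h 0 2 (by decide), by simpa using h 1 0 (by decide), by simpa using h 1 2 (by decide),
      by simpa using h 0 0 (by decide), by simpa using h 1 1 (by decide), by simpa using h 2 2 (by decide)⟩
  · rintro ⟨h01, h02, h10, h12, h00, h11, h22⟩ i j hij
    fin_cases i <;> fin_cases j <;> simp_all (config := {decide := true})

/-! ## §2 The inducing character `σ′_Q` of `D(η,ψ)`: value, its restriction to `B` (★ STD-EMB scalar bridge), triviality on `U`, smoothness -/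

section Inducing

variable [ValuativeRel F] [TopologicalSpace F] [IsNonarchimedeanLocalField F] (η ψ : Fˣ →* ℂˣ)

/-- `σ′_Q(q) z = δ_Q^{1∕2}(q) · ψ_Q(proj_Q q) · z`. [cite: BernsteinZelevinsky1977, §2.3] -/
theorem inducingCharQ_apply (q : ↥(standardParabolicGL F (![false, false, true] : Fin 3 → Bool))) (z : ℂ) :
    (Representation.twist (((Representation.trivial ℂ (Π a : Bool, GL {i : Fin 3 // (![false, false, true] : Fin 3 → Bool) i = a} F) ℂ).twist ((η.comp (Matrix.GeneralLinearGroup.det.comp (Pi.evalMonoidHom (fun a : Bool => GL {i : Fin 3 // (![false, false, true] : Fin 3 → Bool) i = a} F) false))) * (ψ.comp (Matrix.GeneralLinearGroup.det.comp (Pi.evalMonoidHom (fun a : Bool => GL {i : Fin 3 // (![false, false, true] : Fin 3 → Bool) i = a} F) true))))).comp (leviProjection F (![false, false, true] : Fin 3 → Bool))) (rootDeltaChar (standardParabolicGL F (![false, false, true] : Fin 3 → Bool)))) q z = ((rootDeltaChar (standardParabolicGL F (![false, false, true] : Fin 3 → Bool)) q : ℂˣ) : ℂ) * ((((((η.comp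 (Matrix.GeneralLinearGroup.det.comp (Pi.evalMonoidHom (fun a : Bool => GL {i : Fin 3 // (![false, false, true] : Fin 3 → Bool) i = a} F) false))) * (ψ.comp (Matrix.GeneralLinearGroup.det.comp (Pi.evalMonoidHom (fun a : Bool => GL {i : Fin 3 // (![false, false, true] : Fin 3 → Bool) i = a} F) true))))) (leviProjection F (![false, false, true] : Fin 3 → Bool) q) : ℂˣ) : ℂ) * z) := by
  simp only [Representation.twist_apply, MonoidHom.coe_comp, Function.comp_apply, Representation.trivial_apply, smul_eq_mul]

/-- **THE SCALAR BRIDGE** (★ STD-EMB `inducing_scalar_borel_eq`): on `B ≤ Q`, `σ′_Q(b) z = δ_B^{1∕2}(b) · tch θ_D (proj_B b) · z` with `θ_D = (ην½⁻¹, ην½, ψ)` — the inducing character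
of `D(η,ψ)` restricted to `B` IS the inducing character of the principal series `I(θ_D)` (★ E3β₃a `inducingChar_apply`).
[cite: BernsteinZelevinsky1977, 1.7, Prop. 1.9, §2.3] [cite: Zelevinsky1980, §1.2, Prop. 2.10] -/
theorem inducingCharQ_apply_borel {g : GL (Fin 3) F} (hg : g ∈ (standardParabolicGL F (id : Fin 3 → Fin 3))) (z : ℂ) :
    (Representation.twist (((Representation.trivial ℂ (Π a : Bool, GL {i : Fin 3 // (![false, false, true] : Fin 3 → Bool) i = a} F) ℂ).twist ((η.comp (Matrix.GeneralLinearGroup.det.comp (Pi.evalMonoidHom (fun a : Bool => GL {i : Fin 3 // (![false, false, true] : Fin 3 → Bool) i = a} F) false))) * (ψ.comp (Matrix.GeneralLinearGroup.det.comp (Pi.evalMonoidHom (fun a : Bool => GL {i : Fin 3 // (![false, false, true] : Fin 3 → Bool) i = a} F) true))))).comp (leviProjection F (![false, false, true] : Fin 3 → Bool))) (rootDeltaChar (standardParabolicGL F (![false, false, true] : Fin 3 → Bool)))) ⟨g, borel_le_standardParabolicGL monotone_twoOne hg⟩ z =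
      ((rootDeltaChar (standardParabolicGL F (id : Fin 3 → Fin 3)) ⟨g, hg⟩ : ℂˣ) : ℂ) * (((((∏ a : Fin 3, (((![η * ((unramifiedTwist F (1 / 2) : QuasiChar F).toMonoidHom)⁻¹, η * ((unramifiedTwist F (1 / 2) : QuasiChar F).toMonoidHom), ψ] : Fin 3 → (Fˣ →* ℂˣ))) a).comp (Matrix.GeneralLinearGroup.det.comp (Pi.evalMonoidHom (fun a : Fin 3 => GL {i : Fin 3 // (id : Fin 3 → Fin 3) i = a} F) a)))) (leviProjection F (id : Fin 3 → Fin 3) ⟨g, hg⟩) : ℂˣ) : ℂ) * z) := by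
  rw [inducingCharQ_apply]
  exact inducing_scalar_borel_eq η ψ ⟨g, hg⟩ z

/-- `σ′_Q(u) = 1` for `u ∈ U` (`U ≤ B` and the Borel inducing character is trivial on `U`, ★ E3β₃a). [cite: BernsteinZelevinsky1977, 1.7, §1.9] -/
theorem inducingCharQ_apply_of_mem_upperUnitriangular {u : GL (Fin 3) F} (hu : u ∈ (upperUnitriangular (Fin 3) F)) (z : ℂ) :
    (Representation.twist (((Representation.trivial ℂ (Π a : Bool, GL {i : Fin 3 // (![false, false, true] : Fin 3 → Bool) i = a} F) ℂ).twist ((η.comp (Matrix.GeneralLinearGroup.det.comp (Pi.evalMonoidHom (fun a : Bool => GL {i : Fin 3 // (![false, false, true] : Fin 3 → Bool) i = a} F) false))) * (ψ.comp (Matrix.GeneralLinearGroup.det.comp (Pi.evalMonoidHom (fun a : Bool => GL {i : Fin 3 // (![false, false, true] : Fin 3 → Bool) i = a} F) true))))).comp (leviProjection F (![false, false, true] : Fin 3 → Bool))) (rootDeltaChar (standardParabolicGL F (![false, false, true] : Fin 3 → Bool)))) ⟨u, borel_le_standardParabolicGL monotone_twoOne (unipotentRadicalGL_le F (id : Fin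 3 → Fin 3) hu)⟩ z = z := by
  rw [inducingCharQ_apply_borel η ψ (unipotentRadicalGL_le F (id : Fin 3 → Fin 3) hu), ← inducingChar_apply]
  exact inducingChar_apply_of_mem_upperUnitriangular _ hu z

/-- `σ′_Q` is smooth when `ker η`, `ker ψ` are open (★ STD-EMB `isOpen_ker_psiQ`). [cite: BernsteinZelevinsky1977, §1.8, §2.3] -/
theorem isSmooth_inducingCharQ (hη : IsOpen ((η.ker : Subgroup Fˣ) : Set Fˣ)) (hψ : IsOpen ((ψ.ker : Subgroup Fˣ) : Set Fˣ)) : (Representation.twist (((Representation.trivial ℂ (Π a : Bool, GL {i : Fin 3 // (![false, false, true] : Fin 3 → Bool) i = a} F) ℂ).twist ((η.comp (Matrix.GeneralLinearGroup.det.comp (Pi.evalMonoidHom (fun a : Bool => GL {i : Fin 3 // (![false, false, true] : Fin 3 → Bool) i = a} F) false))) * (ψ.comp (Matrix.GeneralLinearGroup.det.comp (Pi.evalMonoidHom (fun a : Bool => GL {i : Fin 3 // (![false, false, true] : Fin 3 → Bool) i = a} F) true))))).comp (leviProjection F (![false, false, true] : Fin 3 → Bool))) (rootDeltaChar (standardParabolicGL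 F (![false, false, true] : Fin 3 → Bool)))).IsSmooth :=
  (isSmooth_trivial_twist (isOpen_ker_psiQ η ψ hη hψ)).twist_comp_leviProjection

end Inducing

/-! ## §3 The three `(Q,B)`-cell data: `w = 1 ↦ (U, 1)`, `s₂ ↦ (U_{Q′}, U_{α₂})`, `s₁s₂ ↦ (U_{α₂}, U_{Q′})`; `P_w Γ_w P_w⁻¹ ⊆ U_Q⁻`, `S_w = {u ∈ U : P_w u P_w⁻¹ ∈ Q}` -/

section Cells

variable [TopologicalSpace F] [IsTopologicalRing F]

omit [TopologicalSpace F] [IsTopologicalRing F] in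
/-- **`(Q,B)`-cell `w = 1`**: `Γ = 1`, `S = U` (`U ≤ Q`). [cite: BernsteinZelevinsky1977, Thm. 5.2] [cite: Casselman1995, §6.3, Prop. 6.3.3] -/
theorem cellDatumQ_one :
    (∀ γ ∈ (⊥ : Subgroup (GL (Fin 3) F)), (permGL ((1 : Equiv.Perm (Fin 3))) : GL (Fin 3) F) * γ * (permGL ((1 : Equiv.Perm (Fin 3))) : GL (Fin 3) F)⁻¹ ∈ (unipotentRadicalGL F (⇑OrderDual.toDual ∘ (![false, false, true] : Fin 3 → Bool)))) ∧
    (∀ u ∈ (upperUnitriangular (Fin 3) F), (permGL ((1 : Equiv.Perm (Fin 3))) : GL (Fin 3) F) * u * (permGL ((1 : Equiv.Perm (Fin 3))) : GL (Fin 3) F)⁻¹ ∈ standardParabolicGL F (![false, false, true] : Fin 3 → Bool) → u ∈ (upperUnitriangular (Fin 3) F)) ∧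
    (∀ s ∈ (upperUnitriangular (Fin 3) F), (permGL ((1 : Equiv.Perm (Fin 3))) : GL (Fin 3) F) * s * (permGL ((1 : Equiv.Perm (Fin 3))) : GL (Fin 3) F)⁻¹ ∈ standardParabolicGL F (![false, false, true] : Fin 3 → Bool)) ∧
    (∀ u ∈ (upperUnitriangular (Fin 3) F), ∃ s ∈ (upperUnitriangular (Fin 3) F), ∃ γ ∈ (⊥ : Subgroup (GL (Fin 3) F)), u = s * γ) := by
  refine ⟨fun γ hγ => ?_, fun u hu _ => hu, fun s hs => ?_, fun u hu => ⟨u, hu, 1, Subgroup.one_mem _, (mul_one u).symm⟩⟩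
  · rw [Subgroup.mem_bot.1 hγ, mul_one, mul_inv_cancel]
    exact Subgroup.one_mem _
  · rw [permGL_one, one_mul, inv_one, mul_one]
    exact borel_le_standardParabolicGL monotone_twoOne (unipotentRadicalGL_le F (id : Fin 3 → Fin 3) hs)

/-- **`(Q,B)`-cell `s₂ = (1 2)`**: `Γ = U_{α₂}` with `P_{s₂} Γ P_{s₂}⁻¹ ⊆ U_Q⁻` (root (1,2) ↦ (2,1)); `S = U_{Q′} = {u ∈ U : P u P⁻¹ ∈ Q}` (`(P u P⁻¹)₂₁ = u₁₂`); `P S P⁻¹ ⊆ Q`; `U = S Γ`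
(★ E3β₁). [cite: BernsteinZelevinsky1977, Thm. 5.2] [cite: Casselman1995, §6.3, Prop. 6.3.3] -/
theorem cellDatumQ_swap_one_two :
    (∀ γ ∈ (unipotentRadicalGL F (![false, false, true] : Fin 3 → Bool) ⊓ standardLeviGL F (![false, true, true] : Fin 3 → Bool)), (permGL (Equiv.swap (1 : Fin 3) 2) : GL (Fin 3) F) * γ * (permGL (Equiv.swap (1 : Fin 3) 2) : GL (Fin 3) F)⁻¹ ∈ (unipotentRadicalGL F (⇑OrderDual.toDual ∘ (![false, false, true] : Fin 3 → Bool)))) ∧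
    (∀ u ∈ (upperUnitriangular (Fin 3) F), (permGL (Equiv.swap (1 : Fin 3) 2) : GL (Fin 3) F) * u * (permGL (Equiv.swap (1 : Fin 3) 2) : GL (Fin 3) F)⁻¹ ∈ standardParabolicGL F (![false, false, true] : Fin 3 → Bool) → u ∈ (unipotentRadicalGL F (![false, true, true] : Fin 3 → Bool))) ∧
    (∀ s ∈ (unipotentRadicalGL F (![false, true, true] : Fin 3 → Bool)), (permGL (Equiv.swap (1 : Fin 3) 2) : GL (Fin 3) F) * s * (permGL (Equiv.swap (1 : Fin 3) 2) : GL (Fin 3) F)⁻¹ ∈ standardParabolicGL F (![false, false, true] : Fin 3 → Bool)) ∧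
    (∀ u ∈ (upperUnitriangular (Fin 3) F), ∃ s ∈ (unipotentRadicalGL F (![false, true, true] : Fin 3 → Bool)), ∃ γ ∈ (unipotentRadicalGL F (![false, false, true] : Fin 3 → Bool) ⊓ standardLeviGL F (![false, true, true] : Fin 3 → Bool)), u = s * γ) := by
  have hw0 : Equiv.swap (1 : Fin 3) 2 0 = 0 := by decide
  have hw1 : Equiv.swap (1 : Fin 3) 2 1 = 2 := by decide
  have hw2 : Equiv.swap (1 : Fin 3) 2 2 = 1 := by decide
  obtain ⟨-, -, hSB, hdec⟩ := cellDatum_swap_one_two (F := F)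
  refine ⟨fun γ hγ => ?_, fun u hu hQ => ?_, fun s hs => borel_le_standardParabolicGL monotone_twoOne (hSB s hs), hdec⟩
  · obtain ⟨hU, h01, h02⟩ := (mem_rootGroup_oneTwo_iff γ).1 hγ
    obtain ⟨h10, h20, h21, h00, h11, h22⟩ := (mem_upperUnitriangular_three_iff γ).1 hU
    rw [mem_oppositeRadical_twoOne_iff]
    simp only [permGL_conj_apply, hw0, hw1, hw2]
    exact ⟨h02, h01, h20, h21, h00, h22, h11⟩
  · obtain ⟨h20', h21'⟩ := (mem_parabolic_twoOne_iff _).1 hQ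
    simp only [permGL_conj_apply, hw0, hw1, hw2] at h20' h21'
    exact (mem_unipotentRadicalGL_oneTwo_iff u).2 ⟨hu, h21'⟩

/-- **`(Q,B)`-cell `s₁s₂ = (0→1→2→0)`**: `Γ = U_{Q′}` with `P Γ P⁻¹ ⊆ U_Q⁻` (roots (0,1),(0,2) ↦ (2,0),(2,1)); `S = U_{α₂} = {u ∈ U : P u P⁻¹ ∈ Q}` (`(P u P⁻¹)₂₀ = u₀₁`, `(P u P⁻¹)₂₁ = u₀₂`);
`P S P⁻¹ ⊆ Q`; `U = S Γ` (★ E3β₁). [cite: BernsteinZelevinsky1977, Thm. 5.2] [cite: Casselman1995, §6.3, Prop. 6.3.3] -/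
theorem cellDatumQ_cycle_one_two_zero :
    (∀ γ ∈ (unipotentRadicalGL F (![false, true, true] : Fin 3 → Bool)), (permGL (Equiv.swap (0 : Fin 3) 1 * Equiv.swap (1 : Fin 3) 2) : GL (Fin 3) F) * γ * (permGL (Equiv.swap (0 : Fin 3) 1 * Equiv.swap (1 : Fin 3) 2) : GL (Fin 3) F)⁻¹ ∈ (unipotentRadicalGL F (⇑OrderDual.toDual ∘ (![false, false, true] : Fin 3 → Bool)))) ∧
    (∀ u ∈ (upperUnitriangular (Fin 3) F), (permGL (Equiv.swap (0 : Fin 3) 1 * Equiv.swap (1 : Fin 3) 2) : GL (Fin 3) F) * u * (permGL (Equiv.swap (0 : Fin 3) 1 * Equiv.swap (1 : Fin 3) 2) : GL (Fin 3) F)⁻¹ ∈ standardParabolicGL F (![false, false, true] : Fin 3 → Bool) → u ∈ (unipotentRadicalGL F (![false, false, true] : Fin 3 → Bool) ⊓ standardLeviGL F (![false, true, true] : Fin 3 → Bool))) ∧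
    (∀ s ∈ (unipotentRadicalGL F (![false, false, true] : Fin 3 → Bool) ⊓ standardLeviGL F (![false, true, true] : Fin 3 → Bool)), (permGL (Equiv.swap (0 : Fin 3) 1 * Equiv.swap (1 : Fin 3) 2) : GL (Fin 3) F) * s * (permGL (Equiv.swap (0 : Fin 3) 1 * Equiv.swap (1 : Fin 3) 2) : GL (Fin 3) F)⁻¹ ∈ standardParabolicGL F (![false, false, true] : Fin 3 → Bool)) ∧
    (∀ u ∈ (upperUnitriangular (Fin 3) F), ∃ s ∈ (unipotentRadicalGL F (![false, false, true] : Fin 3 → Bool) ⊓ standardLeviGL F (![false, true, true] : Fin 3 → Bool)), ∃ γ ∈ (unipotentRadicalGL F (![false, true, true] : Fin 3 → Bool)), u = s * γ) := by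
  have hw0 : (Equiv.swap (0 : Fin 3) 1 * Equiv.swap (1 : Fin 3) 2) 0 = 1 := by decide
  have hw1 : (Equiv.swap (0 : Fin 3) 1 * Equiv.swap (1 : Fin 3) 2) 1 = 2 := by decide
  have hw2 : (Equiv.swap (0 : Fin 3) 1 * Equiv.swap (1 : Fin 3) 2) 2 = 0 := by decide
  obtain ⟨-, -, hSB, hdec⟩ := cellDatum_cycle_one_two_zero (F := F)
  refine ⟨fun γ hγ => ?_, fun u hu hQ => ?_, fun s hs => borel_le_standardParabolicGL monotone_twoOne (hSB s hs), hdec⟩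
  · obtain ⟨hU, h12⟩ := (mem_unipotentRadicalGL_oneTwo_iff γ).1 hγ
    obtain ⟨h10, h20, h21, h00, h11, h22⟩ := (mem_upperUnitriangular_three_iff γ).1 hU
    rw [mem_oppositeRadical_twoOne_iff]
    simp only [permGL_conj_apply, hw0, hw1, hw2]
    exact ⟨h12, h10, h21, h20, h11, h22, h00⟩
  · obtain ⟨h20', h21'⟩ := (mem_parabolic_twoOne_iff _).1 hQ
    simp only [permGL_conj_apply, hw0, hw1, hw2] at h20' h21'
    exact (mem_rootGroup_oneTwo_iff u).2 ⟨hu, h20', h21'⟩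

end Cells

/-! ## §4 The line of the closed cell `w = 1` — for ANY smooth character `σ′` of `Q` agreeing on `B` with the Borel inducing character `δ_B^{1∕2}·(χ ∘ proj_B)` -/

section Line

variable [ValuativeRel F] [TopologicalSpace F] [IsNonarchimedeanLocalField F]
  (σ' : Representation ℂ ↥(standardParabolicGL F (![false, false, true] : Fin 3 → Bool)) ℂ) (χ : (Π a : Fin 3, GL {i : Fin 3 // (id : Fin 3 → Fin 3) i = a} F) →* ℂˣ)

/-- **The closed `(Q,B)`-cell `w = 1` contributes exactly a line to `r_U(Ind_Q σ′)`, with exponent `χ`** — for every smooth character `σ′` of `Q` on `ℂ` whose restriction to `B`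
is `δ_B^{1∕2}·(χ ∘ proj_B)` (`hσB`; for `D(η,ψ)`: ★ `inducingCharQ_apply_borel`, `χ = tch θ_D`).  The Haar functional is evaluation `f ↦ f(1)` (Dirac measure on `Γ = 1`);
`hinv`∕`hT` are `f(u) = f(1)` and `f(diag m) = σ′(diag m) f(1) = δ_B^{1∕2}(diag m) χ(m) f(1)` (★ E3β₃c with `P_{id} ↦ Q`). [cite: BernsteinZelevinsky1977, Thm. 5.2] [cite: Casselman1995, §6.3, Thm. 6.3.5] -/
theorem exists_lineFunctional_cellQ_one (hσ' : σ'.IsSmooth)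
    (hσB : ∀ (g : GL (Fin 3) F) (hg : g ∈ standardParabolicGL F (id : Fin 3 → Fin 3)) (z : ℂ),
      σ' ⟨g, borel_le_standardParabolicGL monotone_twoOne hg⟩ z =
        ((rootDeltaChar (standardParabolicGL F (id : Fin 3 → Fin 3)) ⟨g, hg⟩ : ℂˣ) : ℂ) * ((((χ (leviProjection F (id : Fin 3 → Fin 3) ⟨g, hg⟩)) : ℂˣ) : ℂ) * z)) :
    let I := smoothIndRep (standardParabolicGL F (![false, false, true] : Fin 3 → Bool)) σ'
    let mk := Coinvariants.mk (restrictUnipotentGL F (id : Fin 3 → Fin 3) I)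
    let Flt := (vanishingOn (standardParabolicGL F (![false, false, true] : Fin 3 → Bool)) σ' (cellLT (K := F) (![false, false, true] : Fin 3 → Bool) ((1 : Equiv.Perm (Fin 3))))).map mk
    let Fle := (vanishingOn (standardParabolicGL F (![false, false, true] : Fin 3 → Bool)) σ' (cellLE (K := F) (![false, false, true] : Fin 3 → Bool) ((1 : Equiv.Perm (Fin 3))))).map mk
    ∃ Λ : (restrictUnipotentGL F (id : Fin 3 → Fin 3) I).Coinvariants →ₗ[ℂ] ℂ,
      (∀ x ∈ Flt, Λ x = 0 ↔ x ∈ Fle) ∧ (∃ x ∈ Flt, Λ x ≠ 0) ∧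
      ∀ (m : (Π a : Fin 3, GL {i : Fin 3 // (id : Fin 3 → Fin 3) i = a} F)), ∀ x ∈ Flt,
        Λ (Representation.normalizedJacquetGL F (id : Fin 3 → Fin 3) I m x) =
          ((χ (leviProjection F (id : Fin 3 → Fin 3) ⟨(permGL ((1 : Equiv.Perm (Fin 3))) : GL (Fin 3) F) * blockDiagonalGL F (id : Fin 3 → Fin 3) m * (permGL ((1 : Equiv.Perm (Fin 3))) : GL (Fin 3) F)⁻¹, permGL_conj_blockDiagonalGL_mem_borel ((1 : Equiv.Perm (Fin 3))) m⟩) : ℂˣ) : ℂ) * Λ x := by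
  intro I mk Flt Fle
  -- `σ′` is trivial on `U` (`U ≤ B`, ★ E3β₃a)
  have hσU : ∀ (u : GL (Fin 3) F) (hu : u ∈ upperUnitriangular (Fin 3) F) (z : ℂ),
      σ' ⟨u, borel_le_standardParabolicGL monotone_twoOne (unipotentRadicalGL_le F (id : Fin 3 → Fin 3) hu)⟩ z = z := fun u hu z => by
    rw [hσB _ (unipotentRadicalGL_le F (id : Fin 3 → Fin 3) hu), ← inducingChar_apply]
    exact inducingChar_apply_of_mem_upperUnitriangular χ hu z
  haveI : T2Space F := (isLocalField F).toT2Space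
  haveI : LocallyCompactSpace F := (isLocalField F).toLocallyCompactSpace
  haveI : SecondCountableTopology F := secondCountableTopology_localField F
  letI : MeasurableSpace F := borel F
  haveI : BorelSpace F := ⟨rfl⟩
  obtain ⟨hΓlow, hS, hSB, hdec⟩ := cellDatumQ_one (F := F)
  have hΓU : (⊥ : Subgroup (GL (Fin 3) F)) ≤ upperUnitriangular (Fin 3) F := bot_le
  have hΓcl : IsClosed (((⊥ : Subgroup (GL (Fin 3) F)) : Subgroup (GL (Fin 3) F)) : Set (GL (Fin 3) F)) := by
    rw [Subgroup.coe_bot]; exact isClosed_singleton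
  have hΓlim : IsLimitOfCompactOpen ↥(⊥ : Subgroup (GL (Fin 3) F)) := (isLimitOfCompactOpen_upperUnitriangular F 3).of_le hΓU hΓcl
  letI : MeasurableSpace ↥(⊥ : Subgroup (GL (Fin 3) F)) := borel _
  haveI : BorelSpace ↥(⊥ : Subgroup (GL (Fin 3) F)) := ⟨rfl⟩
  haveI : MeasurableSingletonClass ↥(⊥ : Subgroup (GL (Fin 3) F)) := ⟨fun x => by
    rw [show ({x} : Set ↥(⊥ : Subgroup (GL (Fin 3) F))) = Set.univ from Set.eq_univ_of_forall fun y => Subsingleton.elim y x]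
    exact MeasurableSet.univ⟩
  haveI : IsFiniteMeasureOnCompacts (Measure.dirac (1 : ↥(⊥ : Subgroup (GL (Fin 3) F)))) := ⟨fun K _ => measure_lt_top _ _⟩
  haveI : (Measure.dirac (1 : ↥(⊥ : Subgroup (GL (Fin 3) F)))).IsMulRightInvariant := ⟨fun g => by
    rw [Subsingleton.elim g 1, show (fun x : ↥(⊥ : Subgroup (GL (Fin 3) F)) => x * 1) = id from funext fun x => mul_one x, Measure.map_id]⟩
  haveI : (Measure.dirac (1 : ↥(⊥ : Subgroup (GL (Fin 3) F)))).IsOpenPosMeasure := ⟨fun V hV hne => by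
    obtain ⟨x, hx⟩ := hne
    rw [Subsingleton.elim x 1] at hx
    rw [Measure.dirac_apply_of_mem hx]; exact one_ne_zero⟩
  have hP : (permGL ((1 : Equiv.Perm (Fin 3))) : GL (Fin 3) F) = 1 := permGL_one
  let conjB : (Π a : Fin 3, GL {i : Fin 3 // (id : Fin 3 → Fin 3) i = a} F) →* ↥(standardParabolicGL F (id : Fin 3 → Fin 3)) :=
    ((MulAut.conj (permGL ((1 : Equiv.Perm (Fin 3))) : GL (Fin 3) F)).toMonoidHom.comp (blockDiagonalGL F (id : Fin 3 → Fin 3))).codRestrict (standardParabolicGL F (id : Fin 3 → Fin 3))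
      (fun m => permGL_conj_blockDiagonalGL_mem_borel ((1 : Equiv.Perm (Fin 3))) m)
  let ew : (Π a : Fin 3, GL {i : Fin 3 // (id : Fin 3 → Fin 3) i = a} F) →* ℂˣ := (χ.comp ((leviProjection F (id : Fin 3 → Fin 3)).comp conjB)) *
    (rootDeltaChar (standardParabolicGL F (id : Fin 3 → Fin 3))).comp (leviEmbeddingP F (id : Fin 3 → Fin 3))
  obtain ⟨Λ, hker, hne, hequiv⟩ := K2E3ParabolicCellJacquetLine.exists_lineFunctional_of_cellDatum (![false, false, true] : Fin 3 → Bool) monotone_twoOne σ' (1 : Equiv.Perm (Fin 3)) (⊥ : Subgroup (GL (Fin 3) F)) (upperUnitriangular (Fin 3) F) hσ'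
    hΓU hΓcl hΓlim hΓlow hS hSB hdec (fun _ => 1) continuous_const (fun s hs _ γ => Subsingleton.elim _ _) (Measure.dirac (1 : ↥(⊥ : Subgroup (GL (Fin 3) F))))
    (by
      intro u hu f hf
      rw [integral_dirac, integral_dirac]
      simp only [toFun_smoothIndRep_apply, hP, Subgroup.coe_one, mul_one, one_mul]
      have h := SmoothInd.toFun_subgroup_mul f ⟨u, borel_le_standardParabolicGL monotone_twoOne (unipotentRadicalGL_le F (id : Fin 3 → Fin 3) hu)⟩ 1
      rw [mul_one] at h
      exact h.trans (hσU u hu _)) ew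
    (by
      intro m f hf
      rw [integral_dirac, integral_dirac]
      simp only [toFun_smoothIndRep_apply, hP, Subgroup.coe_one, mul_one, one_mul]
      have hdiagB : blockDiagonalGL F (id : Fin 3 → Fin 3) m ∈ standardParabolicGL F (id : Fin 3 → Fin 3) := (leviEmbeddingP F (id : Fin 3 → Fin 3) m).2
      have h : f.toFun (blockDiagonalGL F (id : Fin 3 → Fin 3) m) = σ' ⟨blockDiagonalGL F (id : Fin 3 → Fin 3) m, borel_le_standardParabolicGL monotone_twoOne hdiagB⟩ (f.toFun 1) := by
        have h1 := SmoothInd.toFun_subgroup_mul f ⟨blockDiagonalGL F (id : Fin 3 → Fin 3) m, borel_le_standardParabolicGL monotone_twoOne hdiagB⟩ 1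
        rwa [mul_one] at h1
      have hconj1 : conjB m = ⟨blockDiagonalGL F (id : Fin 3 → Fin 3) m, hdiagB⟩ :=
        Subtype.ext (show (permGL ((1 : Equiv.Perm (Fin 3))) : GL (Fin 3) F) * blockDiagonalGL F (id : Fin 3 → Fin 3) m * (permGL ((1 : Equiv.Perm (Fin 3))) : GL (Fin 3) F)⁻¹ = blockDiagonalGL F (id : Fin 3 → Fin 3) m by
          rw [hP, one_mul, inv_one, mul_one])
      have hemb : leviEmbeddingP F (id : Fin 3 → Fin 3) m = ⟨blockDiagonalGL F (id : Fin 3 → Fin 3) m, hdiagB⟩ := Subtype.ext (coe_leviEmbeddingP (id : Fin 3 → Fin 3) m)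
      have hew : ((ew m : ℂˣ) : ℂ) = (((χ (leviProjection F (id : Fin 3 → Fin 3) ⟨blockDiagonalGL F (id : Fin 3 → Fin 3) m, hdiagB⟩)) : ℂˣ) : ℂ) * ((rootDeltaChar (standardParabolicGL F (id : Fin 3 → Fin 3)) ⟨blockDiagonalGL F (id : Fin 3 → Fin 3) m, hdiagB⟩ : ℂˣ) : ℂ) := by
        simp only [ew, MonoidHom.mul_apply, MonoidHom.coe_comp, Function.comp_apply, Units.val_mul, hconj1, hemb]
      rw [h, hσB _ hdiagB, hew]
      ring)
  refine ⟨Λ, hker, hne, fun m x hx => ?_⟩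
  rw [hequiv m x hx]
  congr 2
  have hew' : ew * ((rootDeltaChar (standardParabolicGL F (id : Fin 3 → Fin 3))).comp (leviEmbeddingP F (id : Fin 3 → Fin 3)))⁻¹ =
      χ.comp ((leviProjection F (id : Fin 3 → Fin 3)).comp conjB) := by
    ext n
    simp only [ew, MonoidHom.mul_apply, MonoidHom.inv_apply, MonoidHom.coe_comp, Function.comp_apply, mul_inv_cancel_right]
  rw [hew']
  rfl

end Line

end Summit.HodgeConjecture.HodgeConjecture.Cruxes.H413.K2E3GL3StandardModuleJacquetCells

end
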